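import Summits.AtomisticToContinuum.Crystallization.Theorems.FrustratedLawDichotomyTwoShellRigidityGaugedLadderD

/-!
# FrustratedLawDichotomy · crux `AperiodicFrustratedLawGap` (stmt-AtomisticToContinuum-27623) — `CoversProbes26Q`: the covering constant `1`
# of lens-5 g32's RATIONAL-PAIRING probe list (decomp-a2c, prover hand 1, gen 11; critic row 474 (E)(i) «`CoversProbes26Q` (ρ = 1) is an
# S-sized fact for an idle hand»)

`probes26Q = {±√2·e_k} ∪ {(±1,±1,0)/√2 and permutations} ∪ {(±1,±1,±1)/√2}` (`…TwoShellRigidityGaugedLadderD`, p825523) is the probe list whose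
pairings with the fcc / hcp residual coordinates are rational, so that census's rung tables replay in `ℚ` by `linarith`; its covering
constant is exactly `1`: for every `v` some probe `n` has `‖v‖ ≤ ⟪n, v⟫`.  PROOF (`coversProbes26Q`): with `(a, b, c) = (|v₀|, |v₁|, |v₂|)`,
either `a² + b² + c² ≤ 2·v_k²` for some `k` (take the axis probe `±√2·e_k`: `⟪±√2 e_k, v⟫ = √2|v_k|`), or every `v_k²` is less than the sum of
the other two, and then `2(a² + b² + c²) ≤ (a + b + c)²` (`two_mul_sq_sum_le`: if `a` is the largest, `2ab + 2ac ≥ 2b² + 2c² > a² + b² + c²`),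
so the signed triple probe `(±1,±1,±1)/√2` works: `⟪n, v⟫ = (a + b + c)/√2`.  `[folklore]`; def-free; no `sorry`.
-/

noncomputable section

namespace Summit.AtomisticToContinuum.Crystallization.Theorems.FrustratedLawDichotomyTwoShellRigidityProbeCoveringQ

open Summit.AtomisticToContinuum.Crystallization.Theorems.FrustratedLawDichotomyTwoShellRigidityCut (E3)
open Summit.AtomisticToContinuum.Crystallization.Theorems.FrustratedLawDichotomyTwoShellRigidityGaugedLadder
open scoped RealInnerProductSpace

/-- If each of `a², b², c²` is less than the sum of the other two (`a, b, c ≥ 0`) then `2(a² + b² + c²) ≤ (a + b + c)²`. [folklore] -/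
theorem two_mul_sq_sum_le {a b c : ℝ} (ha : 0 ≤ a) (hb : 0 ≤ b) (hc : 0 ≤ c) (h1 : a ^ 2 < b ^ 2 + c ^ 2)
    (h2 : b ^ 2 < a ^ 2 + c ^ 2) (h3 : c ^ 2 < a ^ 2 + b ^ 2) : 2 * (a ^ 2 + b ^ 2 + c ^ 2) ≤ (a + b + c) ^ 2 := by
  rcases le_total b a with hba | hab
  · rcases le_total c a with hca | hac
    · nlinarith [mul_le_mul_of_nonneg_left hba hb, mul_le_mul_of_nonneg_left hca hc, mul_nonneg hb hc]
    · nlinarith [mul_le_mul_of_nonneg_left hac ha, mul_le_mul_of_nonneg_left (hba.trans hac) hb, mul_nonneg ha hb]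
  · rcases le_total c b with hcb | hbc
    · nlinarith [mul_le_mul_of_nonneg_left hab ha, mul_le_mul_of_nonneg_left hcb hc, mul_nonneg ha hc]
    · nlinarith [mul_le_mul_of_nonneg_left hbc hb, mul_le_mul_of_nonneg_left (hab.trans hbc) ha, mul_nonneg ha hb]

/-- **`CoversProbes26Q` — the covering constant of `probes26Q` is `1`.** [folklore] -/
theorem coversProbes26Q : CoversProbes26Q := by
  intro v
  have hn : ‖v‖ ^ 2 = v 0 ^ 2 + v 1 ^ 2 + v 2 ^ 2 := by rw [EuclideanSpace.real_norm_sq_eq, Fin.sum_univ_three]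
  have hr0 : 0 < Real.sqrt 2 := by positivity
  have hr2 : Real.sqrt 2 ^ 2 = 2 := Real.sq_sqrt (by norm_num)
  have hs2 : (Real.sqrt 2)⁻¹ ^ 2 = 1 / 2 := by rw [inv_pow, hr2]; norm_num
  have hs0 : 0 < (Real.sqrt 2)⁻¹ := by positivity
  by_cases h0 : ‖v‖ ^ 2 ≤ 2 * v 0 ^ 2
  · rcases le_or_gt 0 (v 0) with hs | hs
    · refine ⟨vec3 (Real.sqrt 2) 0 0, by simp [probes26Q], ?_⟩
      rw [one_mul, inner_vec3]
      simp only [zero_mul, add_zero]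
      refine (sq_le_sq₀ (norm_nonneg _) (mul_nonneg hr0.le hs)).1 ?_
      rw [mul_pow, hr2]; assumption
    · refine ⟨vec3 (-Real.sqrt 2) 0 0, by simp [probes26Q], ?_⟩
      rw [one_mul, inner_vec3]
      simp only [zero_mul, add_zero]
      refine (sq_le_sq₀ (norm_nonneg _) (mul_nonneg_of_nonpos_of_nonpos (neg_nonpos.2 hr0.le) hs.le)).1 ?_
      rw [mul_pow, neg_sq, hr2]; assumption
  by_cases h1 : ‖v‖ ^ 2 ≤ 2 * v 1 ^ 2
  · rcases le_or_gt 0 (v 1) with hs | hs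
    · refine ⟨vec3 0 (Real.sqrt 2) 0, by simp [probes26Q], ?_⟩
      rw [one_mul, inner_vec3]
      simp only [zero_mul, add_zero, zero_add]
      refine (sq_le_sq₀ (norm_nonneg _) (mul_nonneg hr0.le hs)).1 ?_
      rw [mul_pow, hr2]; assumption
    · refine ⟨vec3 0 (-Real.sqrt 2) 0, by simp [probes26Q], ?_⟩
      rw [one_mul, inner_vec3]
      simp only [zero_mul, add_zero, zero_add]
      refine (sq_le_sq₀ (norm_nonneg _) (mul_nonneg_of_nonpos_of_nonpos (neg_nonpos.2 hr0.le) hs.le)).1 ?_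
      rw [mul_pow, neg_sq, hr2]; assumption
  by_cases h2 : ‖v‖ ^ 2 ≤ 2 * v 2 ^ 2
  · rcases le_or_gt 0 (v 2) with hs | hs
    · refine ⟨vec3 0 0 (Real.sqrt 2), by simp [probes26Q], ?_⟩
      rw [one_mul, inner_vec3]
      simp only [zero_mul, add_zero, zero_add]
      refine (sq_le_sq₀ (norm_nonneg _) (mul_nonneg hr0.le hs)).1 ?_
      rw [mul_pow, hr2]; assumption
    · refine ⟨vec3 0 0 (-Real.sqrt 2), by simp [probes26Q], ?_⟩
      rw [one_mul, inner_vec3]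
      simp only [zero_mul, add_zero, zero_add]
      refine (sq_le_sq₀ (norm_nonneg _) (mul_nonneg_of_nonpos_of_nonpos (neg_nonpos.2 hr0.le) hs.le)).1 ?_
      rw [mul_pow, neg_sq, hr2]; assumption
  -- the signed triple probe
  push Not at h0 h1 h2
  have key : 2 * (|v 0| ^ 2 + |v 1| ^ 2 + |v 2| ^ 2) ≤ (|v 0| + |v 1| + |v 2|) ^ 2 := by
    apply two_mul_sq_sum_le (abs_nonneg _) (abs_nonneg _) (abs_nonneg _) <;> simp only [sq_abs] <;> linarith [hn, h0, h1, h2]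
  have htarget : ∀ n : E3, ⟪n, v⟫ = (Real.sqrt 2)⁻¹ * (|v 0| + |v 1| + |v 2|) → ‖v‖ ≤ 1 * ⟪n, v⟫ := by
    intro n hnv
    rw [one_mul, hnv]
    refine (sq_le_sq₀ (norm_nonneg _) (by positivity)).1 ?_
    rw [mul_pow, hs2, hn]
    simp only [sq_abs] at key
    linarith
  rcases le_or_gt 0 (v 0) with g0 | g0 <;> rcases le_or_gt 0 (v 1) with g1 | g1 <;> rcases le_or_gt 0 (v 2) with g2 | g2
  · refine ⟨vec3 (Real.sqrt 2)⁻¹ (Real.sqrt 2)⁻¹ (Real.sqrt 2)⁻¹, by simp [probes26Q], htarget _ ?_⟩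
    rw [inner_vec3, abs_of_nonneg g0, abs_of_nonneg g1, abs_of_nonneg g2]; ring
  · refine ⟨vec3 (Real.sqrt 2)⁻¹ (Real.sqrt 2)⁻¹ (-(Real.sqrt 2)⁻¹), by simp [probes26Q], htarget _ ?_⟩
    rw [inner_vec3, abs_of_nonneg g0, abs_of_nonneg g1, abs_of_neg g2]; ring
  · refine ⟨vec3 (Real.sqrt 2)⁻¹ (-(Real.sqrt 2)⁻¹) (Real.sqrt 2)⁻¹, by simp [probes26Q], htarget _ ?_⟩
    rw [inner_vec3, abs_of_nonneg g0, abs_of_neg g1, abs_of_nonneg g2]; ring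
  · refine ⟨vec3 (Real.sqrt 2)⁻¹ (-(Real.sqrt 2)⁻¹) (-(Real.sqrt 2)⁻¹), by simp [probes26Q], htarget _ ?_⟩
    rw [inner_vec3, abs_of_nonneg g0, abs_of_neg g1, abs_of_neg g2]; ring
  · refine ⟨vec3 (-(Real.sqrt 2)⁻¹) (Real.sqrt 2)⁻¹ (Real.sqrt 2)⁻¹, by simp [probes26Q], htarget _ ?_⟩
    rw [inner_vec3, abs_of_neg g0, abs_of_nonneg g1, abs_of_nonneg g2]; ring
  · refine ⟨vec3 (-(Real.sqrt 2)⁻¹) (Real.sqrt 2)⁻¹ (-(Real.sqrt 2)⁻¹), by simp [probes26Q], htarget _ ?_⟩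
    rw [inner_vec3, abs_of_neg g0, abs_of_nonneg g1, abs_of_neg g2]; ring
  · refine ⟨vec3 (-(Real.sqrt 2)⁻¹) (-(Real.sqrt 2)⁻¹) (Real.sqrt 2)⁻¹, by simp [probes26Q], htarget _ ?_⟩
    rw [inner_vec3, abs_of_neg g0, abs_of_neg g1, abs_of_nonneg g2]; ring
  · refine ⟨vec3 (-(Real.sqrt 2)⁻¹) (-(Real.sqrt 2)⁻¹) (-(Real.sqrt 2)⁻¹), by simp [probes26Q], htarget _ ?_⟩
    rw [inner_vec3, abs_of_neg g0, abs_of_neg g1, abs_of_neg g2]; ring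

end Summit.AtomisticToContinuum.Crystallization.Theorems.FrustratedLawDichotomyTwoShellRigidityProbeCoveringQ

end
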